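import Literature.AnabelianGeometry.SemiGraphs.SgACoveringHomCanPoints
import Literature.AnabelianGeometry.SemiGraphs.EdgeBasePointTransport
import Literature.AnabelianGeometry.SemiGraphs.TieLabels
import HarnessLib

/-!
# [SemiAnbd] Def. 2.2 (i) / Rem. 2.2.1 for an ABSTRACT four-clause covering, read on profinite
# presentations: the GLOBAL POINT SYSTEM and its alignment (bridge brick L1-glob, definition layer)

Mochizuki, *Semi-graphs of anabelioids*, Publ. RIMS **42** (2006), Def. 2.2 (i) p. 23 (the finite étale
covering `𝒢' → 𝒢` attached to `G' ∈ Ob(B(𝒢))`: "`B' = B(𝒢)_{G'}` … arises naturally as the `B(−)` of …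
`𝒢'`"), Rem. 2.2.1 p. 24 ("the image of each `Π_v` … is equal to the stabilizer of a compatible system of
vertices"), Rem. 2.4.2 p. 26 (the 2-cells `φ_b`), Def. 3.5 (i)/(ii) p. 37 (coverings attached to objects of
`B^cov(G)`; "`B(G) ↪ B^temp(G)`") (kurims `paper:url-f33ace170ff4`). [cite: MochizukiSemiAnbd2006, Rem. 2.2.1 p.24]

Brick of the (R1) bridge law L1 «finite étale ⇒ tempered» for the cell's ABSTRACT four-clause coverings
(HOME/staging/L3/L3-t3/R1-BRIDGE-SHAPES.md §5; interface owner abc-iut-L3-t3).  abc-iut-L3-t3 (gen 6)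
reduced the law to a point system of the finite object `toCovObj A` of `B^cov(𝒦)` on the profinite
reading `ψ.toProfinite` (B2) satisfying (PS1) `GlueCondition`, (PS2) `StabCondition`, (PS3)
`PointAligned` (`SgA.isTemperedCoveringOf_of_pointSystem_toCovObj`), and supplied it for print's
CONSTRUCTED covering at the canonical points.  For an ABSTRACT `ψ : ℋ → 𝒦` with a GLOBAL witness
(`αψ : B(𝒦)_{/A} ⥲ B(ℋ)`, `e_ψ : ψ^* ≅ (A × −) ⋙ αψ`) the right points are the GLOBAL BASE POINTS of the
F-1478 lane (abc-iut-w4-d079 / f-161 / f-160 / w5-d041): the fibre images of the tautological section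
`g = αψ(η_{𝟙_A}) ≫ e_ψ⁻¹_A : αψ 𝟙_A ⟶ ψ^* A` at the one-point fibres of the terminal object `αψ 𝟙_A`,
transported along the chosen paths of B2:

* `Hom.tVGlob` / `tEGlob`, `Hom.yGlob w ∈ F_u(A_u)` / `Hom.zGlobAt e' e pe ∈ F_e(A_e)` / `zGlob` —
  THE GLOBAL POINTS on the profinite presentation of `𝒦`; `castPtE_zGlob` (re-indexing bookkeeping);
* `Hom.conjGlob b' w h'` — the 2-cell conjugator of `ψ.toProfinite` at `b'` for the chosen paths
  (abc-iut-L3-t3 `HomOver.conjOfPaths`), with `hV_brHom_eq_conjGlob`;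
* `Hom.ρ_conjGlob_glue_zGlob` — **the point clause of (PS3)**: the conjugator carries the glued global
  edge point to the global vertex point — abc-iut-w4-d079's (T-α) `globalBasePoint_edge_eq_transport`
  (the edge base point IS the transport of the vertex one along the aligned frame) read through
  `conjOfPaths_smul`; hence `pointAligned_glob` and, as a COROLLARY, (PS1) `glueCondition_glob` — for
  EVERY morphism with a global witness (no alignment clause is used here);
* `Hom.yGlob_mem_range_of_section_factors` (+ edge twin) — the global points lie in the fibre-images of
  the canonical labels of abc-iut-f-161's `TieLabels` (the components through which `g` factors), so that
  the bijectivity of the point lift is abc-iut-f-161's (TIE).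

The stabiliser dictionary (PS2) — where the ALIGNMENT clauses (vertex / branch alignment) enter — is the
proof-only companion `SgAGlobalPointStabilizers.lean`.  Definitions + their laws; nothing of the paper is
asserted; no side taken on [IUTchIII] Cor. 3.12.
-/

noncomputable section

namespace Literature.AnabelianGeometry.SemiGraphs

open CategoryTheory CategoryTheory.Limits CategoryTheory.PreGaloisCategory
open Literature.AnabelianGeometry.Anabelioids

universe u

namespace SemiGraphOfAnabelioids

namespace Hom

variable {ℋ 𝒦 : SemiGraphOfAnabelioids.{u, u, u}} (ψ : Hom ℋ 𝒦) (A : 𝒦.BObj)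
  [HasBinaryProducts 𝒦.BObj] (αψ : Over A ⥤ ℋ.BObj) [αψ.IsEquivalence]
  (eψ : ψ.pullbackFunctor ≅ Over.star A ⋙ αψ)

/-! ### One-point fibres of the global terminal object -/

omit [HasBinaryProducts 𝒦.BObj] in
/-- The fibre at the canonical basepoint of `ℋ_w` of the vertex constituent of the global terminal object
`αψ 𝟙_A` is ONE POINT (the constituent is terminal, `preservesTerminal_ρ`; fibre functors preserve
terminal objects). [cite: MochizukiSemiAnbd2006, Def. 2.1 p.23] -/
theorem subsingleton_fibV_terminal (w : ℋ.graph.Vertex) :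
    Subsingleton ((ℋ.fibV w).obj ((αψ.obj (Over.mk (𝟙 A))).S w)) := by
  haveI : PreservesLimitsOfShape (Discrete PEmpty.{1}) (ℋ.ρ w) := preservesTerminal_ρ ℋ w
  have hT : IsTerminal ((ℋ.ρ w).obj (αψ.obj (Over.mk (𝟙 A)))) :=
    (Over.mkIdTerminal.isTerminalObj αψ _).isTerminalObj (ℋ.ρ w) _
  let i : (ℋ.ρ w).obj (αψ.obj (Over.mk (𝟙 A))) ≅ ⊤_ (ℋ.V w) := hT.uniqueUpToIso terminalIsTerminal
  obtain ⟨eT⟩ := nonempty_equiv_fiber_terminal_punit (ℋ.fibV w)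
  exact ((FintypeCat.equivEquivIso.symm ((ℋ.fibV w).mapIso i)).trans eT).subsingleton

omit [HasBinaryProducts 𝒦.BObj] in
/-- The edge version: the fibre of the edge constituent of `αψ 𝟙_A` is one point.
[cite: MochizukiSemiAnbd2006, Def. 2.1 p.23] -/
theorem subsingleton_fibE_terminal (e' : ℋ.graph.Edge) :
    Subsingleton ((ℋ.fibE e').obj ((αψ.obj (Over.mk (𝟙 A))).T e')) := by
  obtain ⟨-, -, hρE⟩ := ℋ.hasLimitsOfShape_bObj (J := Discrete PEmpty.{1})
  haveI := hρE e'
  have hT : IsTerminal ((ℋ.ρE e').obj (αψ.obj (Over.mk (𝟙 A)))) :=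
    (Over.mkIdTerminal.isTerminalObj αψ _).isTerminalObj (ℋ.ρE e') _
  let i : (ℋ.ρE e').obj (αψ.obj (Over.mk (𝟙 A))) ≅ ⊤_ (ℋ.E e') := hT.uniqueUpToIso terminalIsTerminal
  obtain ⟨eT⟩ := nonempty_equiv_fiber_terminal_punit (ℋ.fibE e')
  exact ((FintypeCat.equivEquivIso.symm ((ℋ.fibE e').mapIso i)).trans eT).subsingleton

omit [HasBinaryProducts 𝒦.BObj] in
/-- A CHOSEN point `t_V` of the one-point fibre `F_w((αψ 𝟙_A)_w)` (non-empty: the constituent is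
connected, abc-iut-f-161 `isConnected_S_terminal`). [cite: MochizukiSemiAnbd2006, Def. 2.1 p.23] -/
def tVGlob (w : ℋ.graph.Vertex) : (ℋ.fibV w).obj ((αψ.obj (Over.mk (𝟙 A))).S w) :=
  haveI := isConnected_S_terminal A αψ w
  Classical.choice (nonempty_fiber_of_isConnected (ℋ.fibV w) ((αψ.obj (Over.mk (𝟙 A))).S w))

omit [HasBinaryProducts 𝒦.BObj] in
/-- A CHOSEN point `t_E` of the one-point fibre `F_{e'}((αψ 𝟙_A)_{e'})`.
[cite: MochizukiSemiAnbd2006, Def. 2.1 p.23] -/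
def tEGlob (e' : ℋ.graph.Edge) : (ℋ.fibE e').obj ((αψ.obj (Over.mk (𝟙 A))).T e') :=
  haveI := isConnected_T_terminal A αψ e'
  Classical.choice (nonempty_fiber_of_isConnected (ℋ.fibE e') ((αψ.obj (Over.mk (𝟙 A))).T e'))

/-! ### The global points on the profinite presentation of `𝒦` -/

/-- **The global vertex point `y_w ∈ F_u(A_u)`** (`u = ψ w`): the point `t_V` pushed along the vertex
constituent `g_w : (αψ 𝟙_A)_w ⟶ ψ_w^*(A_u)` of the tautological section `g = αψ(η_{𝟙_A}) ≫ e_ψ⁻¹_A` and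
the chosen path `γ_w : ψ_w^* ⋙ F_w ≅ F_u` of B2 — the (D1) global base point of the covering for the
basepoint through `w`, read at the canonical basepoint of `𝒦_u`. [cite: MochizukiSemiAnbd2006, Rem. 2.2.1 p.24] -/
def yGlob (w : ℋ.graph.Vertex) :
    (𝒦.fibV (ψ.base.vertexMap w)).obj (A.S (ψ.base.vertexMap w)) :=
  (ψ.over.vertexPath w).hom.app (A.S (ψ.base.vertexMap w))
    ((ℋ.fibV w).map
      ((αψ.map ((Over.forgetAdjStar A).unit.app (Over.mk (𝟙 A))) ≫ eψ.inv.app A).fS w)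
      (tVGlob A αψ w))

/-- **The global edge point `z_{e'} ∈ F_e(A_e)`** at a presentation `pe : ψ e' = e` of the image edge:
`t_E` pushed along the edge constituent `g_{e'}`, re-indexed to `e` (`Hom.reindexIso`), and the chosen
path `γ_{e'} : ψ_{e'}^* ⋙ F_{e'} ≅ F_e` at that presentation. [cite: MochizukiSemiAnbd2006, Rem. 2.2.1 p.24] -/
def zGlobAt (e' : ℋ.graph.Edge) (e : 𝒦.graph.Edge) (pe : ψ.base.edgeMap e' = e) :
    (𝒦.fibE e).obj (A.T e) :=
  (ψ.over.edgePath e' e pe).hom.app (A.T e)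
    ((ℋ.fibE e').map ((ψ.reindexIso e' (ψ.base.edgeMap e') e rfl pe).hom.app A)
      ((ℋ.fibE e').map
        ((αψ.map ((Over.forgetAdjStar A).unit.app (Over.mk (𝟙 A))) ≫ eψ.inv.app A).fT e')
        (tEGlob A αψ e')))

/-- The global edge point at the tautological presentation `ψ e' = ψ e'`.
[cite: MochizukiSemiAnbd2006, Rem. 2.2.1 p.24] -/
def zGlob (e' : ℋ.graph.Edge) : (𝒦.fibE (ψ.base.edgeMap e')).obj (A.T (ψ.base.edgeMap e')) :=
  ψ.zGlobAt A αψ eψ e' (ψ.base.edgeMap e') rfl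

/-- Re-indexing the global edge point along an equality of edges is the global edge point at the
re-indexed presentation. [cite: MochizukiSemiAnbd2006, Rem. 2.4.2 p.26] -/
theorem castPtE_zGlob (e' : ℋ.graph.Edge) (e : 𝒦.graph.Edge) (pe : ψ.base.edgeMap e' = e) :
    (BObj.toCovObj A).castPtE pe (ψ.zGlob A αψ eψ e') = ψ.zGlobAt A αψ eψ e' e pe := by
  subst pe; rfl


/-! ### The aligned frame at the tautological presentation of the image branch -/

omit [HasBinaryProducts 𝒦.BObj] in
/-- The inverse of L4-t17's aligned frame `Hom.alignIso` at the tautological presentation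
`ψ b' = ψ b'`, on points: `alignIso⁻¹ x = F_{e'}(φ_{b'})(α'⁻¹ x)` (bookkeeping).
[cite: MochizukiSemiAnbd2006, Rem. 2.4.2 p.26] -/
theorem alignIso_inv_app_apply (w : ℋ.graph.Vertex) (F' : ℋ.V w ⥤ FintypeCat.{u})
    (b' : ℋ.graph.Branch) (h' : ℋ.graph.abuts b' = some w)
    (Fe' : ℋ.E (ℋ.graph.edgeOf b') ⥤ FintypeCat.{u}) (α' : (ℋ.pull b' w h').pullback ⋙ Fe' ≅ F')
    (X : 𝒦.V (ψ.base.vertexMap w)) (x : ((ψ.φV w).pullback ⋙ F').obj X) :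
    (ψ.alignIso b' w h' (ψ.base.branchMap b') rfl F' Fe' α').inv.app X x =
      Fe'.map ((ψ.φB b' w h').hom.app X) (α'.inv.app ((ψ.φV w).pullback.obj X) x) :=
  rfl

/-! ### The 2-cell conjugator of the profinite reading at a branch -/

/-- **The 2-cell conjugator `k_{b'} ∈ Π_{𝒦,u}` of `ψ.toProfinite` at the branch `b'` abutting to `w`**,
for the chosen paths of B1/B2 (`branchPath`, `vertexPath`, `edgePath`): abc-iut-L3-t3's
`HomOver.conjOfPaths`. [cite: MochizukiSemiAnbd2006, Rem. 2.4.2 p.26] -/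
def conjGlob (b' : ℋ.graph.Branch) (w : ℋ.graph.Vertex) (h' : ℋ.graph.abuts b' = some w) :
    Aut (𝒦.fibV (ψ.base.vertexMap w)) :=
  ψ.over.conjOfPaths b' w h' (ℋ.branchPath b' w h') (ψ.over.vertexPath w)
    (ψ.over.edgePath (ℋ.graph.edgeOf b') (𝒦.graph.edgeOf (ψ.base.branchMap b'))
      (ψ.base.edgeOf_branchMap b').symm)
    (𝒦.branchPath (ψ.base.branchMap b') (ψ.base.vertexMap w) (ψ.base.abuts_branchMap b' w h'))

omit [HasBinaryProducts 𝒦.BObj] in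
/-- **The square of `ψ.toProfinite` at `b'` commutes up to `Inn(conjGlob)`**, in the `castGe` form of
`CovObj.PointAligned` (`hVOfPath_brHomOfPath_eq_conj` + re-indexing `castGe_hEAt`).
[cite: MochizukiSemiAnbd2006, Rem. 2.4.2 p.26] -/
theorem hV_brHom_eq_conjGlob (b' : ℋ.graph.Branch) (w : ℋ.graph.Vertex)
    (h' : ℋ.graph.abuts b' = some w) (x : ℋ.toProfinite.Ge (ℋ.graph.edgeOf b')) :
    ψ.toProfinite.hV w (ℋ.toProfinite.brHom b' w h' x) =
      ψ.conjGlob b' w h' *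
        𝒦.toProfinite.brHom (ψ.base.branchMap b') (ψ.base.vertexMap w)
          (ψ.base.abuts_branchMap b' w h')
          (𝒦.toProfinite.castGe (ψ.base.edgeOf_branchMap b').symm
            (ψ.toProfinite.hE (ℋ.graph.edgeOf b') x)) *
        (ψ.conjGlob b' w h')⁻¹ := by
  change ψ.over.hVProfinite w _ = _ * 𝒦.toProfinite.brHom _ _ _
    (𝒦.toProfinite.castGe (ψ.base.edgeOf_branchMap b').symm
      (ψ.over.hEAt (ℋ.graph.edgeOf b') (ψ.base.edgeMap (ℋ.graph.edgeOf b')) rfl x)) * _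
  rw [HomOver.castGe_hEAt]
  exact ψ.over.hVOfPath_brHomOfPath_eq_conj b' w h' (ℋ.branchPath b' w h') (ψ.over.vertexPath w)
    (ψ.over.edgePath (ℋ.graph.edgeOf b') (𝒦.graph.edgeOf (ψ.base.branchMap b'))
      (ψ.base.edgeOf_branchMap b').symm)
    (𝒦.branchPath (ψ.base.branchMap b') (ψ.base.vertexMap w) (ψ.base.abuts_branchMap b' w h')) x

/-! ### (PS3), the point clause: the conjugator carries the glued edge point to the vertex point -/

/-- abc-iut-w4-d079's (T-α) `globalBasePoint_edge_eq_transport` at the canonical basepoints, the chosen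
branch path of `ℋ` and the tautological presentation `ψ b' = ψ b'`, UNFOLDED: the re-indexed image of
`t_E` under `g_{e'}` is the transport `F_{e'}(ψ_{e'}^*(ψ_b))(alignIso⁻¹ (F_w(g_w) t_V))` of the image of
`t_V` under `g_w`. [cite: MochizukiSemiAnbd2006, Rem. 2.2.1 p.24] -/
theorem globalBasePoint_edge_eq_transport_can (w : ℋ.graph.Vertex) (b' : ℋ.graph.Branch)
    (h' : ℋ.graph.abuts b' = some w) :
    (ℋ.fibE (ℋ.graph.edgeOf b')).map
        ((ψ.reindexIso (ℋ.graph.edgeOf b') (ψ.base.edgeMap (ℋ.graph.edgeOf b'))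
          (𝒦.graph.edgeOf (ψ.base.branchMap b')) rfl
          (ψ.edgeMap_edgeOf_of_branchMap b' _ rfl)).hom.app A)
        ((ℋ.fibE (ℋ.graph.edgeOf b')).map
          ((αψ.map ((Over.forgetAdjStar A).unit.app (Over.mk (𝟙 A))) ≫ eψ.inv.app A).fT
            (ℋ.graph.edgeOf b')) (tEGlob A αψ (ℋ.graph.edgeOf b'))) =
      ((ψ.φE (ℋ.graph.edgeOf b') (𝒦.graph.edgeOf (ψ.base.branchMap b'))
          (ψ.edgeMap_edgeOf_of_branchMap b' _ rfl)).pullback ⋙ ℋ.fibE (ℋ.graph.edgeOf b')).map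
        (A.ψ (ψ.base.branchMap b') (ψ.base.vertexMap w) (ψ.base.abuts_branchMap b' w h')).hom
        ((ψ.alignIso b' w h' (ψ.base.branchMap b') rfl (ℋ.fibV w) (ℋ.fibE (ℋ.graph.edgeOf b'))
            (ℋ.branchPath b' w h')).inv.app (A.S (ψ.base.vertexMap w))
          ((ℋ.fibV w).map
            ((αψ.map ((Over.forgetAdjStar A).unit.app (Over.mk (𝟙 A))) ≫ eψ.inv.app A).fS w)
            (tVGlob A αψ w))) := by
  haveI := subsingleton_fibE_terminal A αψ (ℋ.graph.edgeOf b')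
  exact globalBasePoint_edge_eq_transport ψ A αψ eψ w (ℋ.fibV w) b' h' (ψ.base.branchMap b') rfl
    (ℋ.fibE (ℋ.graph.edgeOf b')) (ℋ.branchPath b' w h') (tVGlob A αψ w)
    (tEGlob A αψ (ℋ.graph.edgeOf b'))

/-- **(PS3), the point clause, for an abstract covering with a global witness**: at every branch `b'`
abutting to `w`, the 2-cell conjugator carries the glued global edge point to the global vertex point,
`conjGlob · glue_{ψ b'}(z_{e(b')}) = y_w`.  Mechanism (as for print's constructed covering,
abc-iut-L3-t3 `BObj.ρ_conjCan_glue_zCan`): `conjGlob` acts by transporting back along the paths of `𝒦`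
(undoing the gluing of `toCovObj A` and the path in `z`), across the 2-cell `φ_{b'}⁻¹` and forth along the
paths of `ℋ` (`conjOfPaths_smul`), where abc-iut-w4-d079's (T-α) identifies the re-indexed edge base point
with the transport of the vertex one along the ALIGNED frame — whose inverse is `φ_{b'}` after the branch
path of `ℋ`. [cite: MochizukiSemiAnbd2006, Rem. 2.2.1 p.24] -/
theorem ρ_conjGlob_glue_zGlob (b' : ℋ.graph.Branch) (w : ℋ.graph.Vertex)
    (h' : ℋ.graph.abuts b' = some w) :
    ((BObj.toCovObj A).SV (ψ.base.vertexMap w)).obj.ρ (ψ.conjGlob b' w h')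
        (((BObj.toCovObj A).glue (ψ.base.branchMap b') (ψ.base.vertexMap w)
            (ψ.base.abuts_branchMap b' w h')).hom.hom.hom
          ((BObj.toCovObj A).castPtE (ψ.base.edgeOf_branchMap b').symm
            (ψ.zGlob A αψ eψ (ℋ.graph.edgeOf b')))) =
      ψ.yGlob A αψ eψ w := by
  have key : ∀ u : (𝒦.fibV (ψ.base.vertexMap w)).obj (A.S (ψ.base.vertexMap w)),
      ((BObj.toCovObj A).SV (ψ.base.vertexMap w)).obj.ρ (ψ.conjGlob b' w h') u =
        ψ.conjGlob b' w h' • u := fun u => rfl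
  rw [castPtE_zGlob, BObj.toCovObj_glue_apply, key, conjGlob]
  erw [HomOver.conjOfPaths_smul]
  -- undo the branch path `α_𝒦` of the gluing
  erw [Iso.hom_inv_id_app_apply]
  -- unfold the edge point: `γ_e(F_{e'}(reindex)(F_{e'}(g_{e'}) t_E))`, and cross `γ_e` by naturality
  rw [zGlobAt]
  erw [← NatTrans.naturality_apply
    (ψ.over.edgePath (ℋ.graph.edgeOf b') (𝒦.graph.edgeOf (ψ.base.branchMap b'))
      (ψ.base.edgeOf_branchMap b').symm).hom]
  erw [Iso.hom_inv_id_app_apply]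
  -- (T-α): the re-indexed edge base point is the transport of the vertex one along the aligned frame
  erw [ψ.globalBasePoint_edge_eq_transport_can A αψ eψ w b' h']
  -- `ψ_b⁻¹ ∘ ψ_b`
  have hcancel : ∀ y,
      ((ψ.over.φE (ℋ.graph.edgeOf b') (𝒦.graph.edgeOf (ψ.base.branchMap b'))
          (ψ.base.edgeOf_branchMap b').symm).pullback ⋙ ℋ.fibE (ℋ.graph.edgeOf b')).map
        (A.ψ (ψ.base.branchMap b') (ψ.base.vertexMap w) (ψ.base.abuts_branchMap b' w h')).inv
        (((ψ.φE (ℋ.graph.edgeOf b') (𝒦.graph.edgeOf (ψ.base.branchMap b'))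
          (ψ.edgeMap_edgeOf_of_branchMap b' _ rfl)).pullback ⋙ ℋ.fibE (ℋ.graph.edgeOf b')).map
        (A.ψ (ψ.base.branchMap b') (ψ.base.vertexMap w) (ψ.base.abuts_branchMap b' w h')).hom y) =
        y := fun y => by
    change ((ψ.φE (ℋ.graph.edgeOf b') (𝒦.graph.edgeOf (ψ.base.branchMap b'))
          (ψ.edgeMap_edgeOf_of_branchMap b' _ rfl)).pullback ⋙ ℋ.fibE (ℋ.graph.edgeOf b')).map _
        (((ψ.φE (ℋ.graph.edgeOf b') (𝒦.graph.edgeOf (ψ.base.branchMap b'))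
          (ψ.edgeMap_edgeOf_of_branchMap b' _ rfl)).pullback ⋙ ℋ.fibE (ℋ.graph.edgeOf b')).map _ y) = y
    rw [← FintypeCat.comp_apply, ← CategoryTheory.Functor.map_comp, Iso.hom_inv_id,
      CategoryTheory.Functor.map_id, FintypeCat.id_apply]
  erw [hcancel]
  -- the aligned frame: `alignIso⁻¹ = F_{e'}(φ_{b'}) ∘ α_ℋ⁻¹`; `φ_{b'}⁻¹ ∘ φ_{b'}`, `α_ℋ ∘ α_ℋ⁻¹`
  rw [alignIso_inv_app_apply]
  have hφB : ∀ y,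
      (ℋ.fibE (ℋ.graph.edgeOf b')).map ((ψ.over.φB b' w h').inv.app (A.S (ψ.base.vertexMap w)))
        ((ℋ.fibE (ℋ.graph.edgeOf b')).map ((ψ.φB b' w h').hom.app (A.S (ψ.base.vertexMap w))) y) =
        y := fun y => by
    change (ℋ.fibE (ℋ.graph.edgeOf b')).map ((ψ.φB b' w h').inv.app (A.S (ψ.base.vertexMap w))) _ = y
    rw [← FintypeCat.comp_apply, ← CategoryTheory.Functor.map_comp, Iso.hom_inv_id_app,
      CategoryTheory.Functor.map_id, FintypeCat.id_apply]
  erw [hφB]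
  erw [Iso.inv_hom_id_app_apply]
  rfl

/-- **(PS3) for an abstract covering with a global witness, at the global points**: the squares of
`ψ.toProfinite` commute up to the conjugators `conjGlob`, which carry the glued global edge points to the
global vertex points. [cite: MochizukiSemiAnbd2006, Rem. 2.2.1 p.24] -/
theorem pointAligned_glob :
    (BObj.toCovObj A).PointAligned ψ.toProfinite (ψ.yGlob A αψ eψ) (fun e' => ψ.zGlob A αψ eψ e') :=
  ⟨fun b' w h' => ⟨ψ.conjGlob b' w h', fun x => ψ.hV_brHom_eq_conjGlob b' w h' x,
    ψ.ρ_conjGlob_glue_zGlob A αψ eψ b' w h'⟩⟩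

/-- **(PS1), the gluing condition, at the global points** — a COROLLARY of the point clause: the glued
global edge point lies in the orbit of the global vertex point (it is carried to it by `conjGlob`).
[cite: MochizukiSemiAnbd2006, Def 3.5(i) p.37] -/
theorem glueCondition_glob :
    (BObj.toCovObj A).GlueCondition ψ.base (ψ.yGlob A αψ eψ) (fun e' => ψ.zGlob A αψ eψ e') :=
  ⟨fun b' w h' => (BTemp.cl_eq_cl_iff _ _ _).mpr ⟨ψ.conjGlob b' w h', ψ.ρ_conjGlob_glue_zGlob A αψ eψ b' w h'⟩⟩

/-! ### The global points lie in the canonical labels of abc-iut-f-161's `TieLabels` -/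

/-- **The global vertex point lies in the fibre-image of the vertex label**: if the vertex constituent
`g_w` of the tautological section factors through `ψ_w^*(P ↪ A_u)` (abc-iut-f-161's label `O(w) = P`),
then `y_w ∈ F_u(P)` (`TieLabels.section_factors_iff_mem_range` at the canonical basepoint, pushed along
the chosen path). [cite: MochizukiSemiAnbd2006, Def. 2.2(i) p.23] -/
theorem yGlob_mem_range_of_section_factors (w : ℋ.graph.Vertex)
    (P : π₀Obj (A.S (ψ.base.vertexMap w)))
    (hP : ∃ k : (αψ.obj (Over.mk (𝟙 A))).S w ⟶
        (ψ.φV w).pullback.obj (P.1 : 𝒦.V (ψ.base.vertexMap w)),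
      k ≫ (ψ.φV w).pullback.map P.1.arrow =
        (αψ.map ((Over.forgetAdjStar A).unit.app (Over.mk (𝟙 A))) ≫ eψ.inv.app A).fS w) :
    ψ.yGlob A αψ eψ w ∈ Set.range ((𝒦.fibV (ψ.base.vertexMap w)).map P.1.arrow) := by
  obtain ⟨x, hx⟩ := (section_factors_iff_mem_range ψ A αψ eψ w (ℋ.fibV w) (tVGlob A αψ w) P).mp hP
  refine ⟨(ψ.over.vertexPath w).hom.app _ x, ?_⟩
  rw [yGlob, ← hx]
  exact (NatTrans.naturality_apply (ψ.over.vertexPath w).hom P.1.arrow x).symm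

/-- **The global edge point lies in the fibre-image of the edge label** (edge twin).
[cite: MochizukiSemiAnbd2006, Def. 2.2(i) p.23] -/
theorem zGlob_mem_range_of_sectionE_factors (e' : ℋ.graph.Edge)
    (Q : π₀Obj (A.T (ψ.base.edgeMap e')))
    (hQ : ∃ k : (αψ.obj (Over.mk (𝟙 A))).T e' ⟶
        (ψ.φE e' (ψ.base.edgeMap e') rfl).pullback.obj (Q.1 : 𝒦.E (ψ.base.edgeMap e')),
      k ≫ (ψ.φE e' (ψ.base.edgeMap e') rfl).pullback.map Q.1.arrow =
        (αψ.map ((Over.forgetAdjStar A).unit.app (Over.mk (𝟙 A))) ≫ eψ.inv.app A).fT e') :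
    ψ.zGlob A αψ eψ e' ∈ Set.range ((𝒦.fibE (ψ.base.edgeMap e')).map Q.1.arrow) := by
  obtain ⟨x, hx⟩ :=
    (sectionE_factors_iff_mem_range ψ A αψ eψ e' (ℋ.fibE e') (tEGlob A αψ e') Q).mp hQ
  refine ⟨(ψ.over.edgePath e' (ψ.base.edgeMap e') rfl).hom.app _ x, ?_⟩
  rw [zGlob, zGlobAt, ← hx]
  erw [CategoryTheory.Functor.map_id, FintypeCat.id_apply]
  exact (NatTrans.naturality_apply (ψ.over.edgePath e' (ψ.base.edgeMap e') rfl).hom Q.1.arrow x).symm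

end Hom

end SemiGraphOfAnabelioids

end Literature.AnabelianGeometry.SemiGraphs

end
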